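import Literature.Computability.QuantumComplexity.SignedCubicForrelation
import Literature.Computability.QuantumComplexity.ForrelationMSubspaceDuality

/-!
# Crux `CubicForrelation.SignedExactCubicForrelationNotPrBPP` (stmt-QuantumAdvantage-13932)

Stub `stub_signReadout` of the line `dual-pingpong-frame` (the SIGN READOUT, "FlatTransfer at `s = 0`").

Let `a b : 𝔽₂ⁿ → 𝔽₂` be an exactly forrelated pair, `Φ(a,b) = ±1`, let `V ⊆ 𝔽₂ⁿ` be a finset of bit
vectors containing `0`, closed under `⊕`, with `|V|² = 2ⁿ` (a half-dimensional subspace; the M-subspace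
clause "all second differences of `b` along `V` vanish" is carried in the statement but not used), and
suppose `a` has SLOPE `μ` on `V^⊥ = {y : (-1)^{v·y} = 1 ∀ v ∈ V}`, i.e.
`(-1)^{a(x)} (-1)^{x·μ} = (-1)^{a(0)}` for every `x ∈ V^⊥`. Then

  `Φ(a,b) = (-1)^{a(0)} · (-1)^{b(μ)}`.

Proof (one Poisson summation). Apply the landed sign transport
`DerivativeWalsh.coset_sum_eq_of_forrelation_eq_one` / `…_neg_one` (`ForrelationSignTransport`) with
`U := V^⊥` (closed under `⊕`: `bxor_mem_perp`) and shift `r := μ`: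
`|U| · ∑_{y : μ ⊕ y ∈ U^⊥} (-1)^{b(y)} = ± √(2ⁿ) · ∑_{x ∈ U} (-1)^{x·μ} (-1)^{a(x)}`. By the slope
hypothesis every `a`-side term is `(-1)^{a(0)}`, so the right-hand sum is `|U| (-1)^{a(0)}`; by
`perp_perp_eq_of_sq`, `U^⊥ = V` and `|U| = |V| = √(2ⁿ)`. Hence `∑_{v ∈ V} (-1)^{b(μ ⊕ v)} = ± |V| (-1)^{a(0)}`,
a sum of `|V|` signs, so every term equals `± (-1)^{a(0)}` (`all_eq_of_sum_eq_card`); at `v = 0` this reads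
`(-1)^{b(μ)} = Φ · (-1)^{a(0)}`.

Tree material used: `coset_sum_eq_of_forrelation_eq_one/neg_one` (`ForrelationSignTransport`),
`bxor_mem_perp`, `perp_perp_eq_of_sq`, `all_eq_of_sum_eq_card` (`ForrelationMSubspaceDuality`),
`bxor_bxor_cancel_left`, `bxor_zeroVec`, `signOf_sq` (`IQPForrelation`).

References: [AaronsonAmbainis2018] S. Aaronson, A. Ambainis, Forrelation, SIAM J. Comput. 47 (2018), §1.1.1;
[Carlet2020] C. Carlet, Boolean Functions for Cryptography and Coding Theory, CUP 2021, Prop. 77 (dual of a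
Maiorana–McFarland bent function).
-/

noncomputable section

set_option linter.dupNamespace false -- D-0017: single-problem summit ⇒ `QuantumAdvantage.QuantumAdvantage` by design

namespace Summit.QuantumAdvantage.QuantumAdvantage.Theorems.SignedExactCubicForrelationNotPrBPP

open Finset
open Literature.Computability.Complexity Literature.Computability.QuantumComplexity
open Literature.Computability.QuantumComplexity.BuzetChailloux (bxor zeroVec)

/-- **Sign readout** (FlatTransfer at `s = 0`). If `Φ(a,b) = ±1`, `V ∋ 0` is closed under `⊕` with
`|V|² = 2ⁿ` (the clause "second differences of `b` along `V` vanish" is not used), and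
`(-1)^{a(x)} (-1)^{x·μ} = (-1)^{a(0)}` for all `x ∈ V^⊥`, then `Φ(a,b) = (-1)^{a(0)} (-1)^{b(μ)}`.
Proof: sign transport `coset_sum_eq_of_forrelation_eq_one/neg_one` at `U := V^⊥`, `r := μ`; the `a`-side
sum is `|V^⊥| (-1)^{a(0)}` by the slope hypothesis, `V^⊥⊥ = V` and `|V^⊥| = |V| = √(2ⁿ)`
(`perp_perp_eq_of_sq`), so `∑_{v ∈ V} (-1)^{b(μ ⊕ v)} = Φ |V| (-1)^{a(0)}` and all these signs agree
(`all_eq_of_sum_eq_card`); evaluate at `v = 0`. [cite: AaronsonAmbainis2018, §1.1.1]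
[cite: Carlet2020, Prop. 77] -/
theorem stub_signReadout :
    ∀ (n : ℕ) (a b : (Fin n → Bool) → Bool) (V : Finset (Fin n → Bool)) (μ : Fin n → Bool),
    (forrelation a b = 1 ∨ forrelation a b = -1) →
    ((zeroVec ∈ V ∧ ∀ x ∈ V, ∀ y ∈ V, bxor x y ∈ V) ∧ (((V).card : ℝ) ^ 2 = (2 : ℝ) ^ (n)) ∧ (∀ u ∈ V, ∀ v ∈ V, ∀ x, (b x ^^ b (bxor x u) ^^ b (bxor x v) ^^ b (bxor x (bxor u v))) = false)) →
    (∀ x ∈ (Finset.univ.filter fun y => ∀ v ∈ V, twist v y = 1), signOf (a x) * twist x μ = signOf (a zeroVec)) →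
    forrelation a b = signOf (a zeroVec) * signOf (b μ) := by
  rintro n a b V μ hΦ ⟨⟨h0, hadd⟩, hcard, -⟩ hslope
  -- `U := V^⊥` is closed under `⊕`; `U^⊥ = V` and `|U| = |V|`
  obtain ⟨-, hUadd⟩ := DerivativeWalsh.bxor_mem_perp V
  obtain ⟨hpp, hcardp⟩ := DerivativeWalsh.perp_perp_eq_of_sq h0 hadd hcard
  have hVpos : (0 : ℝ) < V.card := by exact_mod_cast card_pos.2 ⟨_, h0⟩
  -- `√(2ⁿ) = |V|`
  have hsqrt : Real.sqrt ((2 : ℝ) ^ n) = V.card := by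
    rw [← hcard, Real.sqrt_sq hVpos.le]
  -- the `a`-side sum: every term is `(-1)^{a(0)}`
  have hSa : ∑ x ∈ (univ.filter fun y => ∀ v ∈ V, twist v y = 1), twist x μ * signOf (a x) =
      (V.card : ℝ) * signOf (a zeroVec) := by
    rw [sum_congr rfl fun x hx => (mul_comm _ _).trans (hslope x hx), sum_const, nsmul_eq_mul, hcardp]
  -- the `b`-side index set `{y : μ ⊕ y ∈ U^⊥}` is the coset `{y : μ ⊕ y ∈ V}`
  have hfilt : (univ.filter fun y => ∀ x ∈ (univ.filter fun y => ∀ v ∈ V, twist v y = 1),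
      twist x (bxor μ y) = 1) = univ.filter (fun y => bxor μ y ∈ V) := by
    ext y
    simp only [mem_filter, mem_univ, true_and]
    constructor
    · intro hy
      have : bxor μ y ∈ univ.filter (fun z => ∀ x ∈ (univ.filter fun y => ∀ v ∈ V, twist v y = 1),
          twist x z = 1) := mem_filter.2 ⟨mem_univ _, fun x hx => hy x (mem_filter.1 hx).2⟩
      rwa [hpp] at this
    · intro hy
      have : bxor μ y ∈ univ.filter (fun z => ∀ x ∈ (univ.filter fun y => ∀ v ∈ V, twist v y = 1),
          twist x z = 1) := by rwa [hpp]
      exact fun x hx => (mem_filter.1 this).2 x (mem_filter.2 ⟨mem_univ _, hx⟩)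
  -- reindex the coset sum over `V` (`y = μ ⊕ v`)
  have hre : ∑ y ∈ univ.filter (fun y => bxor μ y ∈ V), signOf (b y) =
      ∑ v ∈ V, signOf (b (bxor μ v)) := by
    refine Finset.sum_nbij' (fun y => bxor μ y) (fun v => bxor μ v) ?_ ?_ ?_ ?_ ?_
    · intro y hy; exact (mem_filter.1 hy).2
    · intro v hv; exact mem_filter.2 ⟨mem_univ _, by rwa [BuzetChailloux.bxor_bxor_cancel_left]⟩
    · intro y _; exact BuzetChailloux.bxor_bxor_cancel_left μ y
    · intro v _; exact BuzetChailloux.bxor_bxor_cancel_left μ v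
    · intro y _; rw [BuzetChailloux.bxor_bxor_cancel_left]
  -- sign transport, both signed cases: `∑_{v ∈ V} (-1)^{b(μ ⊕ v)} = Φ · (-1)^{a(0)} · |V|`
  have key : ∑ v ∈ V, signOf (b (bxor μ v)) = forrelation a b * signOf (a zeroVec) * V.card := by
    rcases hΦ with h | h
    · have k := DerivativeWalsh.coset_sum_eq_of_forrelation_eq_one h hUadd μ
      rw [hfilt, hre, hcardp, hsqrt, hSa] at k
      rw [mul_left_cancel₀ hVpos.ne' k, h]
      ring
    · have k := DerivativeWalsh.coset_sum_eq_of_forrelation_eq_neg_one h hUadd μ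
      rw [hfilt, hre, hcardp, hsqrt, hSa, ← mul_neg] at k
      rw [mul_left_cancel₀ hVpos.ne' k, h]
      ring
  -- all `|V|` signs of the coset sum agree with `Φ · (-1)^{a(0)}`; evaluate at `v = 0`
  have hterms : ∀ v ∈ V, signOf (b (bxor μ v)) = 1 ∨ signOf (b (bxor μ v)) = -1 := by
    intro v _
    rcases Bool.eq_false_or_eq_true (b (bxor μ v)) with h' | h' <;> simp [signOf, h']
  have hc : forrelation a b * signOf (a zeroVec) = 1 ∨ forrelation a b * signOf (a zeroVec) = -1 := by
    rcases hΦ with h | h <;> rcases Bool.eq_false_or_eq_true (a zeroVec) with h' | h' <;>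
      simp [signOf, h, h']
  have hμ := DerivativeWalsh.all_eq_of_sum_eq_card V (fun v => signOf (b (bxor μ v))) hterms
    (forrelation a b * signOf (a zeroVec)) hc key zeroVec h0
  simp only [BuzetChailloux.bxor_zeroVec] at hμ
  rw [hμ]
  linear_combination (-(forrelation a b)) * BuzetChailloux.signOf_sq (a zeroVec)

end Summit.QuantumAdvantage.QuantumAdvantage.Theorems.SignedExactCubicForrelationNotPrBPP

end
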